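/-
Copyright: the b2b-balaban T⁴-continuum CRUX team, row NE7b OWNER lineage `t4-ne7b-p1` (gen 105). Project licence.
-/
import Summits.QuantumFields.BalabanUV.T4Continuum.Spine.NE7b.LocalConditionalStability
import Summits.QuantumFields.BalabanUV.T4Continuum.Spine.NE7b.QuadFormSimDiag
import Mathlib.MeasureTheory.Measure.Lebesgue.EqHaar
import Mathlib.MeasureTheory.Integral.Pi

/-!
# THE GAUSSIAN DOMINATION LEMMA: exponential moments of a dominated quadratic form under a Gaussian are VOLUME-EXTENSIVE
# (in the rank of the form) and COUPLING-FREE — the finite-dimensional content of «LCS-j» for Gaussian one-step kernels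
# (row NE7b, node U5c; kernel theorem of real analysis + the junction to `LocCondStability`)

Cell `pub-balaban`, sub-cell `t4`, spine estimate NE7b (`T4WeightBudget.RelWeightBound`; the cell's OWN estimate — NOT PRINTED in
[Bałaban 1983–89], NOT PROVED).  Crux-route work under `Spine/NE7b/` by the row's OWNER; NOTHING of Bałaban's is named or asserted;
no `T4Continuum/Support` leaf typed; zero `sorry`.

WHY.  On the re-cut road (W-ne7bp1-g103-1∕-2) the ONE residual lemma of Bałaban's kind is `LocalConditionalStability.LocCondStability`:
at every pinned step the MOMENT CARRIER `M` (the kernel-conditional exponential moment of the part `δQ` of the fluctuation action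
sacrificed to extract the pinned event, refuter ρ-ne7bref-g63-2) has conditional expectation `≤ e^{b}` in the term's own state,
with `b = O(1)·|Z|` UNIFORMLY IN THE RUNNING COUPLING.  Print's by-value sentence for this is [Balaban1989LargeFieldII] p. 383
l. 21–28 «The integrals with respect to the fields A_j … are estimated using the positivity properties of the quadratic forms, and
we get the factors exp O(1)|Z_j ∩ Ω_j|» (the 𝐑-quotients of [Balaban1989LargeFieldI] (0.3)–(0.5) pp. 176–177 are of the same kind;
Dimock, *The renormalization group according to Balaban III*, arXiv:1304.0705, (184) is the one-variable case `δ = ½`).  THIS FILE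
PROVES THAT SENTENCE AS A THEOREM OF FINITE-DIMENSIONAL ANALYSIS and wires it to the named `Prop`:
**for a positive-definite form `S` on `ℝⁿ`, a positive-semidefinite `Q` with `Q ≤ δ·S` (`0 ≤ δ < 1`) and `rank Q ≤ r`,
`∫ e^{xᵀQx} e^{−xᵀSx} dx ≤ (1 − δ)^{−r/2} · ∫ e^{−xᵀSx} dx`** — the cost is `e^{b}` with `b = r·(−½ log(1 − δ)) = O(1)·r`,
EXTENSIVE IN THE NUMBER `r` OF DOMINATED DIRECTIONS (for a form living on the variables of a region `Z`, `r ≤ #Z·(components)`: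
the volume `|Z|`, NOT the dimension `n` of the step's fluctuation field) and FREE OF THE COUPLING (the bound is invariant under
`S, Q ↦ βS, βQ`, `β > 0`: `integral_exp_qf_le_of_dominated_smul`).  `…LocalConditionalStability` §4 had the ONE-variable model
(`gaussian_partial_moment`); this is the `n`-variable theorem with a general (non-diagonal) covariance, which is the situation of a
fluctuation integral in a background field.

WHAT IS PROVED ([folklore]; Mathlib: Haar change of variables under a linear map, Fubini on `ℝⁿ`, the Gaussian integral, and the
simultaneous diagonalisation of `…NE7b.QuadFormSimDiag`):
* §1 `integral_comp_mulVec` (`∫ g(Ax) dx = |det A|⁻¹ ∫ g`), `integral_exp_diag_mul_exp_neg` (`∫ e^{Σ dᵢxᵢ²} e^{−Σ xᵢ²} =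
  Π √(π∕(1 − dᵢ))`), `integral_exp_neg_sum_sq`.
* §2 **`integral_exp_qf_le_of_dominated`** (the lemma above), `integral_exp_neg_qf_pos`, `integrable_exp_qf_mul_exp_neg_qf`,
  **`gaussianMoment_le_of_dominated`** (normalised form: the Gaussian expectation of `e^{Q}` is `≤ (√(1−δ))⁻¹ ^ r`),
  `inv_sqrt_pow_eq_exp` (`(√(1−δ))⁻¹ ^ r = e^{r·(−log(1−δ)∕2)}`), **`integral_exp_qf_le_of_dominated_smul`** (coupling-free form),
  `integral_indicator_le_of_dominated` (the two halves composed: the Gaussian large-field TAIL `≤ e^{−θ}·(√(1−δ))⁻¹ ^ r · ∫ e^{−S}`).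
* §3 **`locCondStability_of_carrier_le`**: THE JUNCTION — a moment carrier with `0 ≤ M j g ≤ e^{b j g}` on backgrounds
  (a.e.-strongly measurable) inhabits `LocCondStability T S K μ ρ₀ M b` on any tower whose terms are integrable; with §2 the
  carrier of a GAUSSIAN one-step kernel whose sacrificed form is `δ`-dominated of rank `≤ r` in EVERY background has
  `b = r·(−½ log(1 − δ))` whatever the coupling (`gaussianCarrier_le`).

NOT HERE (honest).  That Bałaban's one-step fluctuation kernels at the live index ARE such Gaussians times small-field characteristic
functions with a background-UNIFORM domination constant `δ` (print: «determined by small field effective actions only», [B15] p. 177;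
the located obstruction for large-field backgrounds is `…LocalConditionalStability.gaussian_partial_moment_shift`) is the (A1c)
INSTANCE — NC-NE7b-α UNRULED; characteristic functions `χ ≤ 1` only lower the moment and positivity of the non-Gaussian small-field
remainder is print's (0.3)–(0.5) [B15], not touched.  BY-NAME EFFECT ON THE WALL: the residual `LocCondStability` is reduced, for
Gaussian kernels, to DISPLAYED linear-algebra data per pinned step (`S_y` PD, `Q_y` PSD, `Q_y ≤ δ S_y`, `rank Q_y ≤ r`) with the
explicit exponent `b = r·(−½ log(1−δ))`; nothing of Bałaban's is discharged.  NE7b NOT PRINTED ∕ NOT PROVED; spine PROVED 0∕9;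
rung (B)+1 on a FINITE torus — NOT infinite volume, NOT the mass gap, NOT Clay.
HONEST DEPENDENCY: continuum YM on T⁴ ⇐ BetaPertH ∧ nine spine estimates (0/9 proved); BetaPertH ⇐ (D1) ∧ (D4) ∧ CAP+tail.
-/

set_option autoImplicit false

open Matrix Finset MeasureTheory Real
open Summit.QuantumFields.BalabanUV.T4Continuum.NE7b.QuadFormSimDiag

namespace Summit.QuantumFields.BalabanUV.T4Continuum.NE7b.GaussianDominatedMoment

/-! ## §1 Linear change of variables on `ℝⁿ` and the product Gaussian -/

section ChangeOfVariables

variable {n : Type*} [Fintype n] [DecidableEq n]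

/-- **LINEAR CHANGE OF VARIABLES** on `ℝⁿ` (Lebesgue measure on `n → ℝ`): for an invertible real matrix `A` and ANY `g`,
`∫ g(A x) dx = |det A|⁻¹ · ∫ g(x) dx` (Mathlib's `map_linearMap_addHaar_pi_eq_smul_addHaar` in integral form; no measurability of
`g` is needed since `x ↦ A x` is a measurable equivalence). [folklore] -/
theorem integral_comp_mulVec (A : Matrix n n ℝ) (hA : A.det ≠ 0) (g : (n → ℝ) → ℝ) :
    ∫ x, g (A *ᵥ x) = |A.det|⁻¹ * ∫ x, g x := by
  have hf : LinearMap.det (Matrix.toLin' A) ≠ 0 := by rwa [LinearMap.det_toLin']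
  let e : (n → ℝ) ≃ᵐ (n → ℝ) :=
    ((Matrix.toLin' A).equivOfDetNeZero hf).toContinuousLinearEquiv.toHomeomorph.toMeasurableEquiv
  have hecoe : (⇑e : (n → ℝ) → (n → ℝ)) = ⇑(Matrix.toLin' A) := rfl
  have hmap : Measure.map (⇑e) volume = ENNReal.ofReal |(LinearMap.det (Matrix.toLin' A))⁻¹| • (volume : Measure (n → ℝ)) := by
    rw [hecoe]
    exact Measure.map_linearMap_addHaar_pi_eq_smul_addHaar hf volume
  have h1 : ∫ y, g y ∂(Measure.map (⇑e) volume) = ∫ x, g (e x) := integral_map_equiv e g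
  rw [hmap, integral_smul_measure, ENNReal.toReal_ofReal (abs_nonneg _), LinearMap.det_toLin', abs_inv,
    smul_eq_mul] at h1
  have h2 : ∀ x, g (e x) = g (A *ᵥ x) := fun x => by
    rw [show e x = Matrix.toLin' A x from congrFun hecoe x, Matrix.toLin'_apply]
  simp_rw [h2] at h1
  exact h1.symm

omit [DecidableEq n] in
/-- **THE PRODUCT GAUSSIAN WITH DIAGONAL SACRIFICE**: `∫ e^{Σ dᵢ xᵢ²} e^{−Σ xᵢ²} dx = Πᵢ √(π ∕ (1 − dᵢ))` on `ℝⁿ` (Fubini +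
`integral_gaussian`; for `dᵢ ≥ 1` both sides vanish by convention, the case of interest is `dᵢ < 1`). [folklore] -/
theorem integral_exp_diag_mul_exp_neg (d : n → ℝ) :
    ∫ x : n → ℝ, exp (∑ i, d i * x i ^ 2) * exp (-(∑ i, x i ^ 2)) = ∏ i, √(π / (1 - d i)) := by
  have h : ∀ x : n → ℝ, exp (∑ i, d i * x i ^ 2) * exp (-(∑ i, x i ^ 2)) = ∏ i, exp (-(1 - d i) * x i ^ 2) := by
    intro x
    rw [← exp_add, ← Finset.sum_neg_distrib, ← Finset.sum_add_distrib, exp_sum]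
    exact Finset.prod_congr rfl fun i _ => by ring_nf
  simp_rw [h]
  rw [integral_fintype_prod_volume_eq_prod (fun i (t : ℝ) => exp (-(1 - d i) * t ^ 2))]
  exact Finset.prod_congr rfl fun i _ => integral_gaussian (1 - d i)

omit [DecidableEq n] in
/-- The unit Gaussian: `∫ e^{−Σ xᵢ²} dx = Πᵢ √π` on `ℝⁿ`. [folklore] -/
theorem integral_exp_neg_sum_sq : ∫ x : n → ℝ, exp (-(∑ i, x i ^ 2)) = ∏ _i : n, √π := by
  have h := integral_exp_diag_mul_exp_neg (n := n) (fun _ => 0)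
  simp only [zero_mul, Finset.sum_const_zero, exp_zero, one_mul, sub_zero, div_one] at h
  exact h

end ChangeOfVariables

/-! ## §2 The Gaussian domination lemma -/

section Domination

variable {n : Type*} [Fintype n] [DecidableEq n]

/-- The one-direction factor: for `t ≤ δ < 1`, `√(π∕(1 − t)) ≤ κ·√π` with `κ = (√(1−δ))⁻¹` if `t ≠ 0` and `κ = 1` if `t = 0`.
[folklore] -/
theorem sqrt_div_le_factor {t δ : ℝ} (htδ : t ≤ δ) (hδ : δ < 1) :
    √(π / (1 - t)) ≤ (if t ≠ 0 then (√(1 - δ))⁻¹ else 1) * √π := by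
  by_cases ht : t ≠ 0
  · rw [if_pos ht, Real.sqrt_div' _ (by linarith : (0 : ℝ) ≤ 1 - t), inv_mul_eq_div]
    have h1 : 0 < √(1 - δ) := Real.sqrt_pos.2 (by linarith)
    exact div_le_div_of_nonneg_left (Real.sqrt_nonneg _) h1 (Real.sqrt_le_sqrt (by linarith))
  · push Not at ht
    rw [if_neg (not_not.2 ht), ht, sub_zero, div_one, one_mul]

/-- **THE GAUSSIAN DOMINATION LEMMA** ([Balaban1989LargeFieldII] p. 383 l. 21–28 «estimated using the positivity properties of
the quadratic forms, and we get the factors exp O(1)|Z_j ∩ Ω_j|» as a theorem of finite-dimensional analysis).  Let `S` be a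
positive-definite and `Q` a positive-semidefinite real quadratic form on `ℝⁿ` with `Q ≤ δ·S` in the Loewner order, `0 ≤ δ < 1`,
and `rank Q ≤ r`.  Then `∫ e^{xᵀQx}·e^{−xᵀSx} dx ≤ (√(1−δ))⁻¹ ^ r · ∫ e^{−xᵀSx} dx`: sacrificing a `δ`-dominated part of a
Gaussian action costs a factor EXTENSIVE IN THE NUMBER OF DOMINATED DIRECTIONS `r` — not in the dimension `n` — and independent
of the size of `S`.  Proof: simultaneous diagonalisation (`QuadFormSimDiag.exists_simDiag_dominated`), the linear change of
variables, Fubini, the one-dimensional Gaussian, and `#{i : dᵢ ≠ 0} = rank Q`. [folklore] -/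
theorem integral_exp_qf_le_of_dominated {S Q : Matrix n n ℝ} {δ : ℝ} {r : ℕ} (hS : S.PosDef) (hQ : Q.PosSemidef)
    (hdom : (δ • S - Q).PosSemidef) (hδ0 : 0 ≤ δ) (hδ : δ < 1) (hr : Q.rank ≤ r) :
    ∫ x, exp (x ⬝ᵥ (Q *ᵥ x)) * exp (-(x ⬝ᵥ (S *ᵥ x))) ≤
      (√(1 - δ))⁻¹ ^ r * ∫ x, exp (-(x ⬝ᵥ (S *ᵥ x))) := by
  obtain ⟨A, d, hA, hSA, hQA, -, hdδ, hcard⟩ := exists_simDiag_dominated hS hQ hdom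
  have hdet : 0 < |A.det| := abs_pos.2 hA
  -- both integrals in the diagonalising coordinates
  have e1 : ∫ x, exp (x ⬝ᵥ (Q *ᵥ x)) * exp (-(x ⬝ᵥ (S *ᵥ x))) = |A.det| * ∏ i, √(π / (1 - d i)) := by
    have h := integral_comp_mulVec A hA (fun x => exp (x ⬝ᵥ (Q *ᵥ x)) * exp (-(x ⬝ᵥ (S *ᵥ x))))
    simp only [hSA, hQA] at h
    rw [integral_exp_diag_mul_exp_neg] at h
    exact ((eq_inv_mul_iff_mul_eq₀ hdet.ne').1 h).symm
  have e2 : ∫ x, exp (-(x ⬝ᵥ (S *ᵥ x))) = |A.det| * ∏ _i : n, √π := by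
    have h := integral_comp_mulVec A hA (fun x => exp (-(x ⬝ᵥ (S *ᵥ x))))
    simp only [hSA] at h
    rw [integral_exp_neg_sum_sq] at h
    exact ((eq_inv_mul_iff_mul_eq₀ hdet.ne').1 h).symm
  rw [e1, e2]
  -- the count: `Π κᵢ = κ^{#{dᵢ ≠ 0}} ≤ κ^r`
  set κ : ℝ := (√(1 - δ))⁻¹ with hκ
  have hκ1 : 1 ≤ κ := one_le_inv_iff₀.2 ⟨Real.sqrt_pos.2 (by linarith), Real.sqrt_le_one.2 (by linarith)⟩
  have hprod : ∏ i, √(π / (1 - d i)) ≤ κ ^ r * ∏ _i : n, √π := by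
    calc ∏ i, √(π / (1 - d i)) ≤ ∏ i, ((if d i ≠ 0 then κ else 1) * √π) :=
          Finset.prod_le_prod (fun i _ => Real.sqrt_nonneg _) fun i _ => sqrt_div_le_factor (hdδ i) hδ
      _ = (∏ i, (if d i ≠ 0 then κ else 1)) * ∏ _i : n, √π := Finset.prod_mul_distrib
      _ = κ ^ Fintype.card {i // d i ≠ 0} * ∏ _i : n, √π := by
          rw [Finset.prod_ite, Finset.prod_const_one, mul_one, Finset.prod_const, Fintype.card_subtype]
      _ ≤ κ ^ r * ∏ _i : n, √π := by
          refine mul_le_mul_of_nonneg_right (pow_le_pow_right₀ hκ1 (hcard ▸ hr)) ?_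
          exact Finset.prod_nonneg fun _ _ => Real.sqrt_nonneg _
  calc |A.det| * ∏ i, √(π / (1 - d i)) ≤ |A.det| * (κ ^ r * ∏ _i : n, √π) :=
        mul_le_mul_of_nonneg_left hprod hdet.le
    _ = κ ^ r * (|A.det| * ∏ _i : n, √π) := by ring

/-- The Gaussian normalisation of a positive-definite form is positive: `0 < ∫ e^{−xᵀSx} dx`. [folklore] -/
theorem integral_exp_neg_qf_pos {S : Matrix n n ℝ} (hS : S.PosDef) : 0 < ∫ x, exp (-(x ⬝ᵥ (S *ᵥ x))) := by
  obtain ⟨A, d, hA, hSA, -⟩ := exists_simDiag_dominated (Q := 0) (δ := 0) hS Matrix.PosSemidef.zero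
    (by rw [zero_smul, sub_zero]; exact Matrix.PosSemidef.zero)
  have hdet : 0 < |A.det| := abs_pos.2 hA
  have h := integral_comp_mulVec A hA (fun x => exp (-(x ⬝ᵥ (S *ᵥ x))))
  simp only [hSA] at h
  rw [integral_exp_neg_sum_sq] at h
  rw [← (eq_inv_mul_iff_mul_eq₀ hdet.ne').1 h]
  exact mul_pos hdet (Finset.prod_pos fun _ _ => Real.sqrt_pos.2 Real.pi_pos)

/-- Under the hypotheses of the lemma the sacrificed Gaussian IS integrable (its integral is a positive number). [folklore] -/
theorem integrable_exp_qf_mul_exp_neg_qf {S Q : Matrix n n ℝ} {δ : ℝ} (hS : S.PosDef) (hQ : Q.PosSemidef)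
    (hdom : (δ • S - Q).PosSemidef) (hδ : δ < 1) :
    Integrable (fun x : n → ℝ => exp (x ⬝ᵥ (Q *ᵥ x)) * exp (-(x ⬝ᵥ (S *ᵥ x)))) := by
  obtain ⟨A, d, hA, hSA, hQA, -, hdδ, -⟩ := exists_simDiag_dominated hS hQ hdom
  have hdet : 0 < |A.det| := abs_pos.2 hA
  refine Integrable.of_integral_ne_zero (ne_of_gt ?_)
  have h := integral_comp_mulVec A hA (fun x => exp (x ⬝ᵥ (Q *ᵥ x)) * exp (-(x ⬝ᵥ (S *ᵥ x))))
  simp only [hSA, hQA] at h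
  rw [integral_exp_diag_mul_exp_neg] at h
  rw [← (eq_inv_mul_iff_mul_eq₀ hdet.ne').1 h]
  exact mul_pos hdet (Finset.prod_pos fun i _ => Real.sqrt_pos.2 (div_pos Real.pi_pos (by linarith [hdδ i])))

/-- **NORMALISED FORM**: the Gaussian expectation of `e^{xᵀQx}` under the probability density `∝ e^{−xᵀSx}` is at most
`(√(1−δ))⁻¹ ^ r`. [folklore] -/
theorem gaussianMoment_le_of_dominated {S Q : Matrix n n ℝ} {δ : ℝ} {r : ℕ} (hS : S.PosDef) (hQ : Q.PosSemidef)
    (hdom : (δ • S - Q).PosSemidef) (hδ0 : 0 ≤ δ) (hδ : δ < 1) (hr : Q.rank ≤ r) :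
    (∫ x, exp (x ⬝ᵥ (Q *ᵥ x)) * exp (-(x ⬝ᵥ (S *ᵥ x)))) / (∫ x, exp (-(x ⬝ᵥ (S *ᵥ x)))) ≤ (√(1 - δ))⁻¹ ^ r :=
  (div_le_iff₀ (integral_exp_neg_qf_pos hS)).2 (integral_exp_qf_le_of_dominated hS hQ hdom hδ0 hδ hr)

/-- The cost in exponential currency: `(√(1−δ))⁻¹ ^ r = e^{r·(−log(1−δ)∕2)}` — i.e. `b = r·(−½ log(1−δ)) = O(1)·r`. [folklore] -/
theorem inv_sqrt_pow_eq_exp {δ : ℝ} (hδ : δ < 1) (r : ℕ) :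
    (√(1 - δ))⁻¹ ^ r = exp (r * (-Real.log (1 - δ) / 2)) := by
  have h1 : 0 < 1 - δ := by linarith
  have hs : √(1 - δ) = exp (Real.log (1 - δ) / 2) := by
    rw [Real.sqrt_eq_iff_mul_self_eq h1.le (exp_pos _).le, ← exp_add, add_halves, Real.exp_log h1]
  rw [Real.exp_nat_mul, hs, ← Real.exp_neg]
  congr 2
  ring

/-- **COUPLING-FREE FORM** («uniformly in the running coupling»): for every `β > 0` the same bound, with the SAME constant, holds for
the rescaled pair `βS, βQ` — the hypotheses are scale invariant and so is the cost `(√(1−δ))⁻¹ ^ r`. [folklore] -/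
theorem integral_exp_qf_le_of_dominated_smul {S Q : Matrix n n ℝ} {δ β : ℝ} {r : ℕ} (hS : S.PosDef) (hQ : Q.PosSemidef)
    (hdom : (δ • S - Q).PosSemidef) (hδ0 : 0 ≤ δ) (hδ : δ < 1) (hr : Q.rank ≤ r) (hβ : 0 < β) :
    ∫ x, exp (x ⬝ᵥ ((β • Q) *ᵥ x)) * exp (-(x ⬝ᵥ ((β • S) *ᵥ x))) ≤
      (√(1 - δ))⁻¹ ^ r * ∫ x, exp (-(x ⬝ᵥ ((β • S) *ᵥ x))) := by
  refine integral_exp_qf_le_of_dominated (hS.smul hβ) (hQ.smul hβ.le) ?_ hδ0 hδ ?_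
  · rw [smul_comm, ← smul_sub]
    exact hdom.smul hβ.le
  · -- `rank (βQ) = rank Q`
    have hu : IsUnit (β • (1 : Matrix n n ℝ)).det := by
      rw [det_smul, det_one, mul_one]
      exact isUnit_iff_ne_zero.2 (pow_ne_zero _ hβ.ne')
    have e : β • Q = (β • (1 : Matrix n n ℝ)) * Q := by rw [Matrix.smul_mul, Matrix.one_mul]
    rw [e, Matrix.rank_mul_eq_right_of_isUnit_det _ _ hu]
    exact hr

/-- **THE TWO HALVES COMPOSED UNDER A GAUSSIAN — the large-field tail** (Chebyshev `…LocalConditionalStability.chebyshev_extraction`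
× domination): the Gaussian mass of the event «the `δ`-dominated rank-`≤ r` form exceeds `θ`» is at most
`e^{−θ}·(√(1−δ))⁻¹ ^ r · ∫ e^{−xᵀSx}` — a small factor `e^{−θ}` per extracted threshold at the volume-extensive, coupling-free price
(print's «we estimate the factors by exp(−p₀(g_j))», [Balaban1989LargeFieldII] p. 383, in the Gaussian model). [folklore] -/
theorem integral_indicator_le_of_dominated {S Q : Matrix n n ℝ} {δ : ℝ} {r : ℕ} (hS : S.PosDef) (hQ : Q.PosSemidef)
    (hdom : (δ • S - Q).PosSemidef) (hδ0 : 0 ≤ δ) (hδ : δ < 1) (hr : Q.rank ≤ r) (θ : ℝ) :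
    ∫ x, Set.indicator {x | θ ≤ x ⬝ᵥ (Q *ᵥ x)} (fun _ => (1 : ℝ)) x * exp (-(x ⬝ᵥ (S *ᵥ x))) ≤
      exp (-θ) * (√(1 - δ))⁻¹ ^ r * ∫ x, exp (-(x ⬝ᵥ (S *ᵥ x))) := by
  have hχ : ∀ x : n → ℝ, Set.indicator {x | θ ≤ x ⬝ᵥ (Q *ᵥ x)} (fun _ => (1 : ℝ)) x ≤
      exp (-(1 * θ)) * exp (1 * (x ⬝ᵥ (Q *ᵥ x))) := by
    refine LocalConditionalStability.chebyshev_extraction_single _ _ zero_le_one (fun x => ?_) (fun x hx => ?_)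
    · exact Set.indicator_le_self' (fun _ _ => zero_le_one) x
    · by_contra h
      exact hx (Set.indicator_of_notMem (show x ∉ {x : n → ℝ | θ ≤ x ⬝ᵥ (Q *ᵥ x)} from h) _)
  calc ∫ x, Set.indicator {x | θ ≤ x ⬝ᵥ (Q *ᵥ x)} (fun _ => (1 : ℝ)) x * exp (-(x ⬝ᵥ (S *ᵥ x)))
      ≤ ∫ x, exp (-θ) * (exp (x ⬝ᵥ (Q *ᵥ x)) * exp (-(x ⬝ᵥ (S *ᵥ x)))) := by
        refine integral_mono_of_nonneg (Filter.Eventually.of_forall fun x => ?_)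
          ((integrable_exp_qf_mul_exp_neg_qf hS hQ hdom hδ).const_mul _) (Filter.Eventually.of_forall fun x => ?_)
        · exact mul_nonneg (Set.indicator_nonneg (fun _ _ => zero_le_one) x) (exp_pos _).le
        · have h := mul_le_mul_of_nonneg_right (hχ x) (exp_pos (-(x ⬝ᵥ (S *ᵥ x)))).le
          simpa only [one_mul, mul_assoc] using h
    _ = exp (-θ) * ∫ x, exp (x ⬝ᵥ (Q *ᵥ x)) * exp (-(x ⬝ᵥ (S *ᵥ x))) := integral_const_mul _ _
    _ ≤ exp (-θ) * ((√(1 - δ))⁻¹ ^ r * ∫ x, exp (-(x ⬝ᵥ (S *ᵥ x)))) :=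
        mul_le_mul_of_nonneg_left (integral_exp_qf_le_of_dominated hS hQ hdom hδ0 hδ hr) (exp_pos _).le
    _ = exp (-θ) * (√(1 - δ))⁻¹ ^ r * ∫ x, exp (-(x ⬝ᵥ (S *ᵥ x))) := by ring

end Domination

/-! ## §3 The junction to `LocCondStability`: a background-uniform carrier bound inhabits the named `Prop` -/

section Junction

open Summit.QuantumFields.BalabanUV.T4Continuum.B16HistoryIndexedRepr Summit.QuantumFields.BalabanUV.T4Continuum.B16HistoryReprChain
open Summit.QuantumFields.BalabanUV.T4Continuum.NE7b.PrefixExtraction Summit.QuantumFields.BalabanUV.T4Continuum.NE7b.LocalConditionalStability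

variable {P : Type} [DecidableEq P] {C : ℕ → Type} {𝒢 : (j : ℕ) → GoodClass (C j)}

/-- **LCS FROM A BACKGROUND-UNIFORM CARRIER BOUND.**  On a history tower with integrable terms, a moment carrier that is
a.e.-strongly measurable and satisfies `0 ≤ M j g y ≤ e^{b j g}` for EVERY background `y` (at the pattern prefixes of the levels
`j < K`) inhabits `LocCondStability T S K μ ρ₀ M b` — integrability conjunct included.  This is the form in which print states the
factor («exp O(1)|Z_j ∩ Ω_j|», a sup over small-field backgrounds); §2 supplies `b` for Gaussian kernels. [folklore] -/
theorem locCondStability_of_carrier_le (T : Tower P C 𝒢) (S : (j : ℕ) → (Fin j → P) → Finset P) (K : ℕ)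
    [∀ j, MeasurableSpace (C j)] (μ : (j : ℕ) → Measure (C j)) (ρ₀ : C 0 → ℝ) (M : (j : ℕ) → (Fin j → P) → C j → ℝ)
    (b : (j : ℕ) → (Fin j → P) → ℝ) (hρ : (𝒢 0).Gd ρ₀) (h0 : ∀ x, 0 ≤ ρ₀ x)
    (hMm : ∀ j g, j < K → g ∈ admS T S j → AEStronglyMeasurable (M j g) (μ j))
    (hM0 : ∀ j g, j < K → g ∈ admS T S j → ∀ y, 0 ≤ M j g y)
    (hMb : ∀ j g, j < K → g ∈ admS T S j → ∀ y, M j g y ≤ exp (b j g))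
    (hint : ∀ j g, j < K → g ∈ admS T S j → Integrable (T.eterm ρ₀ j g) (μ j)) :
    LocCondStability T S K μ ρ₀ M b := by
  intro j g hj hg
  have hMe : Integrable (fun y => M j g y * T.eterm ρ₀ j g y) (μ j) :=
    (hint j g hj hg).bdd_mul (hMm j g hj hg) (Filter.Eventually.of_forall fun y => by
      rw [Real.norm_eq_abs, abs_of_nonneg (hM0 j g hj hg y)]; exact hMb j g hj hg y)
  refine ⟨hMe, ?_⟩
  calc ∫ y, M j g y * T.eterm ρ₀ j g y ∂μ j ≤ ∫ y, exp (b j g) * T.eterm ρ₀ j g y ∂μ j :=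
        integral_mono hMe ((hint j g hj hg).const_mul _) fun y =>
          mul_le_mul_of_nonneg_right (hMb j g hj hg y) (T.eterm_nonneg hρ h0 j g y)
    _ = exp (b j g) * ∫ y, T.eterm ρ₀ j g y ∂μ j := integral_const_mul _ _

variable {n : Type*} [Fintype n] [DecidableEq n]

/-- **THE GAUSSIAN CARRIER IS BACKGROUND-UNIFORMLY BOUNDED.**  If for every background `y` the one-step kernel's sacrificed
moment is the normalised Gaussian moment of a positive-semidefinite form `Q y` dominated by `δ` times a positive-definite `S y`
with `rank (Q y) ≤ r` — WHATEVER the forms' size (the coupling) and shape (the background) — then the carrier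
`M y = (∫ e^{Q y} e^{−S y}) ∕ (∫ e^{−S y})` satisfies `0 ≤ M y ≤ e^{b}` with the explicit `b = r·(−log(1−δ)∕2)`: the input
`hM0`∕`hMb` of `locCondStability_of_carrier_le` with a `y`-independent exponent. [folklore] -/
theorem gaussianCarrier_le {Y : Type*} (S Q : Y → Matrix n n ℝ) {δ : ℝ} {r : ℕ} (hS : ∀ y, (S y).PosDef)
    (hQ : ∀ y, (Q y).PosSemidef) (hdom : ∀ y, (δ • S y - Q y).PosSemidef) (hδ0 : 0 ≤ δ) (hδ : δ < 1)
    (hr : ∀ y, (Q y).rank ≤ r) (y : Y) :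
    0 ≤ (∫ x, exp (x ⬝ᵥ (Q y *ᵥ x)) * exp (-(x ⬝ᵥ (S y *ᵥ x)))) / (∫ x, exp (-(x ⬝ᵥ (S y *ᵥ x)))) ∧
      (∫ x, exp (x ⬝ᵥ (Q y *ᵥ x)) * exp (-(x ⬝ᵥ (S y *ᵥ x)))) / (∫ x, exp (-(x ⬝ᵥ (S y *ᵥ x)))) ≤
        exp (r * (-Real.log (1 - δ) / 2)) := by
  refine ⟨div_nonneg (integral_nonneg fun x => ?_) (integral_exp_neg_qf_pos (hS y)).le, ?_⟩
  · exact mul_nonneg (exp_pos _).le (exp_pos _).le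
  · rw [← inv_sqrt_pow_eq_exp hδ]
    exact gaussianMoment_le_of_dominated (hS y) (hQ y) (hdom y) hδ0 hδ (hr y)

end Junction

end Summit.QuantumFields.BalabanUV.T4Continuum.NE7b.GaussianDominatedMoment
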